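import Literature.Analysis.FluidPDE.ClassicalNSBlowupAlternative
import Literature.Analysis.FluidPDE.NSCriticalClosureTao
import HarnessLib

/-!
# The Serrin `L^∞_t L^∞_x` endpoint in the Beale–Kato–Majda class on `ℝ³`: a classical solution
# whose velocity stays bounded continues in the class (no blow-up below a velocity ceiling)

Analysis/FluidPDE **proofs file** (theorems only: no definitions, no named facts, no `sorry`).
The classical continuation principle for the unforced Navier–Stokes system on `ℝ³` (`ν > 0`):
«if `T* < ∞` is the maximal time of existence of the regular solution then
`‖u(t)‖_{L^∞} → ∞` as `t → T*`» (Leray 1934, §33, (3.17)–(3.18); Robinson–Rodrigo–Sadowski 2016,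
Lemma 8.16 / Thm. 8.17 with `r = 2`, `s = ∞`: «blowup at time `T` is impossible» for a solution in a
Serrin class; Ożański–Pooley 2018, Cor. 6.25), written in the class in which the tree states
Beale–Kato–Majda / Constantin–Fefferman and in which the D-0090 claim skeletons type «smooth
solution on `[0,T)`» (`Literature.Claims.NS.Chae2007.IsLocalSolution`): classical solutions on the
half-open slab `[0, T) × ℝ³` with all `L²` Sobolev norms bounded on every closed sub-slab
`[0, T″]`, `T″ < T` (`HasBoundedSobolevNormsOn`).

* `hasSobolevExtensionPast_of_norm_le` — if `‖u(t,x)‖ ≤ M` on `[0, T) × ℝ³` then `u` continues in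
  the class past `T` (`HasSobolevExtensionPast ν u T`: a classical solution on some `[0, T′)`,
  `T′ > T`, agreeing with `u` on `[0, T)`, with all Sobolev norms bounded on `[0, T]`).
* `hasBoundedSobolevNormsOn_Ico_of_norm_le` — under the same bound, all Sobolev norms of `u`
  itself are bounded on `[0, T)` (so `T` is not a blow-up time in the sense of
  `Literature.Claims.NS.Chae2007.BlowsUpAt`).
* `hasSobolevExtensionPast_of_norm_le_near`, `hasBoundedSobolevNormsOn_Ico_of_norm_le_near` — the
  same with the bound assumed only on `[ε, T) × ℝ³` for some `0 < ε < T` (on `[0, ε]` the class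
  bounds the velocity, `exists_forall_norm_le_of_hasBoundedSobolevNormsOn`).
* `exists_norm_gt_of_not_hasSobolevExtensionPast` — contrapositive: at a time past which `u` does
  not continue in the class, the velocity is unbounded on every `[ε, T) × ℝ³`.

The tree already has the Leray–Hopf-side statement `hasSmoothExtensionPast_of_bounded_holds`
(`KNSSTypeIIHolds.lean`: hypotheses `IsLerayHopfOn T ν 0 (u 0) u`, conclusion
`HasSmoothExtensionPast`, no Sobolev bounds exported); the present file needs no Leray–Hopf
hypothesis and exports the class.

## Proof (every input is a theorem of the tree)

Apply the blow-up alternative for smooth finite-energy solutions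
(`finiteEnergy_classical_dichotomy`, `ClassicalNSBlowupAlternative.lean`) to the datum `u(0)`,
which is smooth, divergence free and `H^∞` (the class at `T″ = T/2`). In the first branch the
closed slab `[0, T+1]` carries a finite-energy classical solution `w` from `u(0)`; Tao's persistence
of regularity (`IsClassicalNSSolutionOn.hasBoundedSobolevNormsOn_of_sobolevDatum_unforced`,
Tao 2013 Cor. 11.1) puts it in the class on `[0, T+1]`, and Tao's uniqueness of smooth
finite-energy solutions (`IsClassicalNSSolutionOn.eq_of_finiteEnergy`, Cor. 11.4) identifies `w`
with `u` on every `[0, T″]`, `T″ < T` — no velocity bound is needed in this branch. In the second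
branch there is a maximal time `T*` with a finite-energy classical solution `w` on `[0, T*)` from
`u(0)` whose velocity is unbounded: if `T* > T`, `w` itself is the continuation (persistence on the
closed slab `[0, T]`, uniqueness as before); if `T* ≤ T`, uniqueness on the closed slabs
`[0, T″] ⊂ [0, T*)` gives `w = u` on `[0, T*)`, where `u` is bounded by `M` — contradicting the
blow-up of `w`.

## Mathlib / tree search

Mathlib has no Navier–Stokes theory. Tree (`lean search 'hasSobolevExtensionPast_of'`):
`…_of_uniform_H1_bound` (H1ContinuationSobolevClass), `…_of_H3_bound_of_parts`,
`…_of_hasBoundedSobolevNormsOn_of_parts` (NSVorticityBKMContinuation),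
`…_of_two_vorticity_components_*` (Chae–Choe); `hasSmoothExtensionPast_of_bounded_holds`,
`exists_classical_extension_of_bounded_rep`, `exists_classical_extension_Icc_of_apriori_bound`
are Leray–Hopf-scaffolded. No BKM-class statement from a velocity bound existed.

## References

* J. Leray, *Sur le mouvement d'un liquide visqueux emplissant l'espace*, Acta Math. 63 (1934),
  §33 with (3.17)–(3.18). [Leray1934]
* J. C. Robinson, J. L. Rodrigo, W. Sadowski, *The Three-Dimensional Navier–Stokes Equations*,
  CUP (2016), Lemma 8.16, Thm. 8.17 (PDF p. 131), proof of Thm. 12.3 (p. 170).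
  [RobinsonRodrigoSadowski2016]
* W. S. Ożański, B. C. Pooley, *Leray's fundamental work on the Navier–Stokes equations*,
  arXiv:1708.09787 (2018), Cor. 6.25, §3.3. [OzanskiPooley2018]
* T. Tao, *Localisation and compactness properties of the Navier–Stokes global regularity
  problem*, Anal. PDE 6 (2013) = arXiv:1108.1165, Thm. 5.4, Cor. 11.1, Cor. 11.4. [Tao2011]
-/

noncomputable section

open MeasureTheory Set Function Filter Topology
open scoped ENNReal NNReal ContDiff

namespace Literature.Analysis.FluidPDE

variable {ν T : ℝ} {u : ℝ → EuclideanSpace ℝ (Fin 3) → EuclideanSpace ℝ (Fin 3)}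
  {p : ℝ → EuclideanSpace ℝ (Fin 3) → ℝ}

/-- Finite energy on a time set from the Beale–Kato–Majda class (its `n = 0` bound), in the
`∃ A < ⊤` form of the blow-up alternative. [folklore] -/
private theorem finiteEnergy_of_bkmClass {S : Set ℝ} (h : HasBoundedSobolevNormsOn S u) :
    ∃ A : ℝ≥0∞, A < ⊤ ∧ ∀ t ∈ S, ∫⁻ x, ‖u t x‖ₑ ^ 2 ≤ A := by
  obtain ⟨C, hC⟩ := h 0
  refine ⟨C, ENNReal.coe_lt_top, fun t ht => ?_⟩
  rw [lintegral_enorm_sq_eq_lintegral_iteratedFDeriv_zero]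
  exact hC t ht

/-- The `∃ C : ℝ≥0` form of a finite energy bound (hypothesis shape of Tao's persistence theorem).
[folklore] -/
private theorem energy_nnreal_of_finiteEnergy {S : Set ℝ}
    {w : ℝ → EuclideanSpace ℝ (Fin 3) → EuclideanSpace ℝ (Fin 3)}
    (h : ∃ A : ℝ≥0∞, A < ⊤ ∧ ∀ t ∈ S, ∫⁻ x, ‖w t x‖ₑ ^ 2 ≤ A) :
    ∃ C : ℝ≥0, ∀ t ∈ S, ∫⁻ x, ‖w t x‖ₑ ^ 2 ≤ C := by
  obtain ⟨A, hA, hAE⟩ := h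
  exact ⟨A.toNNReal, fun t ht => (hAE t ht).trans (ENNReal.coe_toNNReal hA.ne).ge⟩

/-- The datum of a solution in the class is `H^∞`: `∫ ‖Dⁿ u(0)‖² < ∞` for every `n` (the class on
`[0, T/2]` at `t = 0`). [folklore] -/
private theorem sobolevDatum_of_bkmClass (hT : 0 < T)
    (hreg : ∀ T'' < T, HasBoundedSobolevNormsOn (Icc 0 T'') u) (n : ℕ) :
    ∫⁻ x, ‖iteratedFDeriv ℝ n (u 0) x‖ₑ ^ 2 < ⊤ := by
  obtain ⟨C, hC⟩ := hreg (T / 2) (by linarith) n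
  exact lt_of_le_of_lt (hC 0 ⟨le_rfl, by linarith⟩) ENNReal.coe_lt_top

/-- **Uniqueness step.** A finite-energy classical solution `w` on a closed slab `[0, S]` from the
datum `u(0)` agrees with the class solution `u` at every `t ∈ [0, S] ∩ [0, T)` (Tao 2013, Cor. 11.4
in the tree: `IsClassicalNSSolutionOn.eq_of_finiteEnergy`, applied on `[0, S]` and `[0, (t+T)/2]`).
[cite: Tao2011, Cor. 11.4 (arXiv Cor. 71)] -/
theorem eq_of_finiteEnergy_closed_slab (hν : 0 < ν) (hT : 0 < T)
    (hsol : IsClassicalNSSolutionOn (Ico 0 T) ν 0 u p)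
    (hreg : ∀ T'' < T, HasBoundedSobolevNormsOn (Icc 0 T'') u) {S : ℝ}
    {w : ℝ → EuclideanSpace ℝ (Fin 3) → EuclideanSpace ℝ (Fin 3)}
    {q : ℝ → EuclideanSpace ℝ (Fin 3) → ℝ} (hw : IsClassicalNSSolutionOn (Icc 0 S) ν 0 w q)
    (hw0 : w 0 = u 0) (hEw : ∃ A : ℝ≥0∞, A < ⊤ ∧ ∀ t ∈ Icc 0 S, ∫⁻ x, ‖w t x‖ₑ ^ 2 ≤ A)
    {t : ℝ} (ht : t ∈ Ico 0 T) (htS : t ≤ S) : w t = u t := by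
  -- the datum has `∇u(0) ∈ L²`
  have hu₀ : ContDiff ℝ ∞ (u 0) := hsol.contDiff_velocity ⟨le_rfl, hT⟩
  have hH := sobolevDatum_of_bkmClass hT hreg
  have hH1 : MemLp (fderiv ℝ (u 0)) 2 volume := by
    have h1 : ∫⁻ x, ‖fderiv ℝ (u 0) x‖ₑ ^ 2 < ⊤ := by
      refine lt_of_le_of_lt (le_of_eq (lintegral_congr fun x => ?_)) (hH 1)
      rw [← ofReal_norm, ← ofReal_norm, norm_iteratedFDeriv_one]
    exact ⟨(hu₀.continuous_fderiv (by simp)).aestronglyMeasurable,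
      eLpNorm_two_lt_top_of_lintegral_enorm_sq_lt_top h1⟩
  -- `u` on the closed slab `[0, T'']`, `T'' = (t + T)/2`
  set T'' : ℝ := (t + T) / 2 with hT''
  have hT''pos : 0 < T'' := by rw [hT'']; linarith [ht.1]
  have hT''T : T'' < T := by rw [hT'']; linarith [ht.2]
  have htT'' : t ≤ T'' := by rw [hT'']; linarith [ht.2]
  have hsol'' : IsClassicalNSSolutionOn (Icc 0 T'') ν 0 u p :=
    hsol.mono (Icc_subset_Ico_right hT''T) (uniqueDiffOn_Icc hT''pos)
  exact IsClassicalNSSolutionOn.eq_of_finiteEnergy hν hH1 hw hsol'' hw0 rfl hEw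
    (finiteEnergy_of_bkmClass (hreg T'' hT''T)) ⟨ht.1, htS⟩ htT''

/-- **The Serrin `L^∞_t L^∞_x` endpoint in the Beale–Kato–Majda class** (Leray 1934, §33;
Robinson–Rodrigo–Sadowski 2016, Lemma 8.16 / Thm. 8.17 with `r = 2`, `s = ∞`). Let `ν > 0`,
`T > 0`, and let `(u, p)` be a classical solution of the unforced Navier–Stokes system on
`[0, T) × ℝ³` with all `L²` Sobolev norms bounded on every closed sub-slab `[0, T″]`, `T″ < T`. If
`‖u(t, x)‖ ≤ M` on `[0, T) × ℝ³`, then `u` continues in the class past `T`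
(`HasSobolevExtensionPast ν u T`). Proof: module docstring (blow-up alternative
`finiteEnergy_classical_dichotomy`, persistence `hasBoundedSobolevNormsOn_of_sobolevDatum_unforced`,
uniqueness `eq_of_finiteEnergy_closed_slab`).
[cite: RobinsonRodrigoSadowski2016, Lemma 8.16 and Thm. 8.17 (PDF p. 131)] [cite: Leray1934, §33 (3.17)–(3.18)] -/
theorem hasSobolevExtensionPast_of_norm_le (hν : 0 < ν) (hT : 0 < T)
    (hsol : IsClassicalNSSolutionOn (Ico 0 T) ν 0 u p)
    (hreg : ∀ T'' < T, HasBoundedSobolevNormsOn (Icc 0 T'') u)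
    {M : ℝ} (hM : ∀ t ∈ Ico 0 T, ∀ x, ‖u t x‖ ≤ M) :
    HasSobolevExtensionPast ν u T := by
  have h0 : (0 : ℝ) ∈ Ico 0 T := ⟨le_rfl, hT⟩
  have hu₀ : ContDiff ℝ ∞ (u 0) := hsol.contDiff_velocity h0
  have hdiv : VectorCalculus.IsDivFree (u 0) := hsol.divFree 0 h0
  have hH := sobolevDatum_of_bkmClass hT hreg
  rcases finiteEnergy_classical_dichotomy hν hu₀ hdiv hH with hall | hblow
  · -- (a) every closed slab carries a finite-energy classical solution: take `[0, T + 1]`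
    obtain ⟨w, q, hw, hw0, hEw⟩ := hall (T + 1) (by linarith)
    refine ⟨T + 1, by linarith, w, q, hw.mono Ico_subset_Icc_self (uniqueDiffOn_Ico 0 (T + 1)),
      ?_, fun t ht => ?_⟩
    · have hB : HasBoundedSobolevNormsOn (Icc 0 (T + 1)) w :=
        hw.hasBoundedSobolevNormsOn_of_sobolevDatum_unforced hν (by linarith)
          (energy_nnreal_of_finiteEnergy hEw) (by rw [hw0]; exact hH)
      exact hB.mono (Icc_subset_Icc_right (by linarith))
    · exact eq_of_finiteEnergy_closed_slab hν hT hsol hreg hw hw0 hEw ht (by linarith [ht.2])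
  · -- (b) a maximal finite-energy classical solution on `[0, T*)` with unbounded velocity
    obtain ⟨Ts, hTs, w, q, hw, hw0, hEw, hunb, -⟩ := hblow
    by_cases hTT : T < Ts
    · -- `T* > T`: the maximal solution is the continuation
      have hwT : IsClassicalNSSolutionOn (Icc 0 T) ν 0 w q :=
        hw.mono (Icc_subset_Ico_right hTT) (uniqueDiffOn_Icc hT)
      have hEwT : ∃ A : ℝ≥0∞, A < ⊤ ∧ ∀ t ∈ Icc 0 T, ∫⁻ x, ‖w t x‖ₑ ^ 2 ≤ A := by
        obtain ⟨A, hA, hAE⟩ := hEw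
        exact ⟨A, hA, fun t ht => hAE t ⟨ht.1, ht.2.trans_lt hTT⟩⟩
      refine ⟨Ts, hTT, w, q, hw, ?_, fun t ht => ?_⟩
      · exact hwT.hasBoundedSobolevNormsOn_of_sobolevDatum_unforced hν hT
          (energy_nnreal_of_finiteEnergy hEwT) (by rw [hw0]; exact hH)
      · exact eq_of_finiteEnergy_closed_slab hν hT hsol hreg hwT hw0 hEwT ht ht.2.le
    · -- `T* ≤ T`: `w = u` on `[0, T*)`, where `u` is bounded — contradiction
      exfalso
      have hTsT : Ts ≤ T := le_of_not_gt hTT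
      obtain ⟨t, ht, x, hlt⟩ := hunb M
      -- the closed slab `[0, S]`, `S = (t + T*)/2 < T* ≤ T`
      set S : ℝ := (t + Ts) / 2 with hS
      have hSpos : 0 < S := by rw [hS]; linarith [ht.1]
      have hSTs : S < Ts := by rw [hS]; linarith [ht.2]
      have htS : t ≤ S := by rw [hS]; linarith [ht.2]
      have hwS : IsClassicalNSSolutionOn (Icc 0 S) ν 0 w q :=
        hw.mono (Icc_subset_Ico_right hSTs) (uniqueDiffOn_Icc hSpos)
      have hEwS : ∃ A : ℝ≥0∞, A < ⊤ ∧ ∀ t ∈ Icc 0 S, ∫⁻ x, ‖w t x‖ₑ ^ 2 ≤ A := by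
        obtain ⟨A, hA, hAE⟩ := hEw
        exact ⟨A, hA, fun t ht => hAE t ⟨ht.1, ht.2.trans_lt hSTs⟩⟩
      have htT : t ∈ Ico 0 T := ⟨ht.1, ht.2.trans_le hTsT⟩
      have heq : w t = u t := eq_of_finiteEnergy_closed_slab hν hT hsol hreg hwS hw0 hEwS htT htS
      have hle : ‖w t x‖ ≤ M := by rw [heq]; exact hM t htT x
      exact (not_lt.2 hle) hlt

/-- **No blow-up in the class below a velocity ceiling**: under the hypotheses of
`hasSobolevExtensionPast_of_norm_le`, all `L²` Sobolev norms of `u` itself are bounded on the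
half-open slab `[0, T)` (read off the continuation, which agrees with `u` there and lies in the
class on `[0, T]`). [cite: RobinsonRodrigoSadowski2016, Lemma 8.16 and Thm. 8.17 (PDF p. 131)] -/
theorem hasBoundedSobolevNormsOn_Ico_of_norm_le (hν : 0 < ν) (hT : 0 < T)
    (hsol : IsClassicalNSSolutionOn (Ico 0 T) ν 0 u p)
    (hreg : ∀ T'' < T, HasBoundedSobolevNormsOn (Icc 0 T'') u)
    {M : ℝ} (hM : ∀ t ∈ Ico 0 T, ∀ x, ‖u t x‖ ≤ M) :
    HasBoundedSobolevNormsOn (Ico 0 T) u := by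
  obtain ⟨T', -, U, P, -, hUB, hUeq⟩ := hasSobolevExtensionPast_of_norm_le hν hT hsol hreg hM
  intro n
  obtain ⟨C, hC⟩ := hUB n
  exact ⟨C, fun t ht => by rw [← hUeq t ht]; exact hC t (Ico_subset_Icc_self ht)⟩

/-- **The endpoint with the bound assumed only near `T`.** If `‖u(t, x)‖ ≤ M` on `[ε, T) × ℝ³` for
some `0 < ε < T`, then `u` continues in the class past `T`: on the compact slab `[0, ε]` the class
bounds the velocity (`exists_forall_norm_le_of_hasBoundedSobolevNormsOn`, Sobolev embedding
`H² ⊂ C_B`), so `hasSobolevExtensionPast_of_norm_le` applies with the ceiling `max B M`.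
[cite: RobinsonRodrigoSadowski2016, Lemma 8.16 and Thm. 8.17 (PDF p. 131)] [cite: Leray1934, §33 (3.17)–(3.18)] -/
theorem hasSobolevExtensionPast_of_norm_le_near (hν : 0 < ν) (hT : 0 < T)
    (hsol : IsClassicalNSSolutionOn (Ico 0 T) ν 0 u p)
    (hreg : ∀ T'' < T, HasBoundedSobolevNormsOn (Icc 0 T'') u)
    {ε M : ℝ} (hε : ε ∈ Ioo 0 T) (hM : ∀ t ∈ Ico ε T, ∀ x, ‖u t x‖ ≤ M) :
    HasSobolevExtensionPast ν u T := by
  have hsolε : IsClassicalNSSolutionOn (Icc 0 ε) ν 0 u p :=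
    hsol.mono (Icc_subset_Ico_right hε.2) (uniqueDiffOn_Icc hε.1)
  obtain ⟨B, -, hB⟩ := exists_forall_norm_le_of_hasBoundedSobolevNormsOn hsolε (hreg ε hε.2)
  refine hasSobolevExtensionPast_of_norm_le hν hT hsol hreg (M := max B M) fun t ht x => ?_
  rcases lt_or_ge t ε with h | h
  · exact (hB t ⟨ht.1, h.le⟩ x).trans (le_max_left _ _)
  · exact (hM t ⟨h, ht.2⟩ x).trans (le_max_right _ _)

/-- The class bounds on `[0, T)` under a velocity bound near `T` (combination of
`hasSobolevExtensionPast_of_norm_le_near` and the continuation's agreement with `u`).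
[cite: RobinsonRodrigoSadowski2016, Lemma 8.16 and Thm. 8.17 (PDF p. 131)] -/
theorem hasBoundedSobolevNormsOn_Ico_of_norm_le_near (hν : 0 < ν) (hT : 0 < T)
    (hsol : IsClassicalNSSolutionOn (Ico 0 T) ν 0 u p)
    (hreg : ∀ T'' < T, HasBoundedSobolevNormsOn (Icc 0 T'') u)
    {ε M : ℝ} (hε : ε ∈ Ioo 0 T) (hM : ∀ t ∈ Ico ε T, ∀ x, ‖u t x‖ ≤ M) :
    HasBoundedSobolevNormsOn (Ico 0 T) u := by
  obtain ⟨T', -, U, P, -, hUB, hUeq⟩ :=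
    hasSobolevExtensionPast_of_norm_le_near hν hT hsol hreg hε hM
  intro n
  obtain ⟨C, hC⟩ := hUB n
  exact ⟨C, fun t ht => by rw [← hUeq t ht]; exact hC t (Ico_subset_Icc_self ht)⟩

/-- **Leray's characterisation of a blow-up time, BKM-class form** (Leray 1934, §33: at the end
`T*` of an epoch of regularity `max |u|` increases indefinitely; Ożański–Pooley 2018, Cor. 6.25):
if `u` does not continue in the class past `T`, then for every `0 < ε < T` and every `M` there are
`t ∈ [ε, T)` and `x` with `‖u(t, x)‖ > M`. [cite: Leray1934, §33 (3.17)–(3.18)] [cite: OzanskiPooley2018, Cor. 6.25] -/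
theorem exists_norm_gt_of_not_hasSobolevExtensionPast (hν : 0 < ν) (hT : 0 < T)
    (hsol : IsClassicalNSSolutionOn (Ico 0 T) ν 0 u p)
    (hreg : ∀ T'' < T, HasBoundedSobolevNormsOn (Icc 0 T'') u)
    (hno : ¬ HasSobolevExtensionPast ν u T) {ε : ℝ} (hε : ε ∈ Ioo 0 T) (M : ℝ) :
    ∃ t ∈ Ico ε T, ∃ x, M < ‖u t x‖ := by
  by_contra h
  push Not at h
  exact hno (hasSobolevExtensionPast_of_norm_le_near hν hT hsol hreg hε h)

end Literature.Analysis.FluidPDE
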